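import Literature.Computability.Complexity.HardcoreInapproximabilitySecondMomentBound
import Literature.Analysis.Matrix.HolderMinkowskiEquality
import HarnessLib

/-!
# The maximiser of the hard-core second-moment exponent is unique (GŠV15 Lemma 3.2)

Companion of `HardcoreInapproximabilitySecondMomentBound.lean` (the bound
`pair_table_entropy_le_two_slyPhi1`: the exponent of any probability table of the paired hard-core
model is `≤ 2 Φ₁(p⁺, p⁻)`). Here: **equality forces the product table** — the uniqueness half of
Sly's Condition 1.2 at the dominant phase, for every `d ≥ 3` and `λ > λ_c(𝕋_d)`, again by
Galanis–Štefankovič–Vigoda's computer-free matrix-norm argument (JACM 2015, Lemma 3.2).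

* `eq_smul_of_gibbs_eq` — equality in Gibbs' inequality forces `y = (Σ y) · w` (strict Jensen).
* `cross_eq_of_slyBlam_rows_proportional` — if the `B_λ`-images of the rows of a `2 × 2` matrix are
  proportional then the matrix has rank one (`B_λ` is invertible).
* `eq_mul_of_cross_eq` — a rank-one table with prescribed equal margins is the product of the margins.
* `slyTable1` (the single-layer hard-core edge table with densities `(α, β)`),
  `eq_slyTable1_of_margins`, `eq_of_mul_self_eq`.
* **`pair_table_eq_product_of_entropy_eq`** — if a pair table `x` with both layer marginals
  `(p⁺, p⁻)` attains `d Σ x(log(B_λ ⊗ B_λ) - log x) + (d-1)(Σ γ log γ + Σ δ log δ) = 2 Φ₁(p⁺,p⁻)`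
  then `x = slyTable1 p⁺ p⁻ ⊗ slyTable1 p⁺ p⁻` (so the overlaps are `γ = α ⊗ α`, `δ = β ⊗ β`:
  Sly's `(γ*, δ*, ε*) = (α², β², α(1-α-β))`). Proof: the chain Jensen ≤ Hölder ≤ Bennett ≤ norm
  value is tight at every step; Bennett's equality (`bennett_eq_rows_proportional`) makes `δ^e`
  rank one, the marginal constraints give `δ = β ⊗ β`; Hölder's equality gives `γ ∝ ((B⊗B)δ^e)^d`,
  a product, so `γ = α ⊗ α`; Jensen's equality `x ∝ (B ⊗ B) γ^e δ^e` then factorises, and the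
  factor is identified by its margins.

Not here: the transfer from tables to Sly's three overlap variables `(γ, δ, ε)` and the
compactness/continuity consequences (strict gap away from the product point, uniformly for slices
near the dominant phase) — next files.

## References
* A. Galanis, D. Štefankovič, E. Vigoda, J. ACM 62 (2015), Lemma 3.2 (and §3.3, §4.1).
* A. Sly, FOCS 2010, Condition 1.2 ("attains its unique maximum … at `(α², β², α(1-α-β))`").
-/

namespace Literature.Computability.Complexity

open Real Finset Literature.Probability.LatticeModels

section GibbsEq

variable {J : Type*} [Fintype J]

/-- **Gibbs' inequality, equality case**: for a probability vector `w` and `y ≥ 0` positive on the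
support of `w`, `Σ_j w_j (log y_j - log w_j) = log Σ_j y_j` forces `y = (Σ y) · w`. [folklore] -/
theorem eq_smul_of_gibbs_eq (w y : J → ℝ) (hw0 : ∀ j, 0 ≤ w j) (hw1 : ∑ j, w j = 1)
    (hy0 : ∀ j, 0 ≤ y j) (hy : ∀ j, 0 < w j → 0 < y j)
    (heq : ∑ j, w j * (Real.log (y j) - Real.log (w j)) = Real.log (∑ j, y j)) :
    ∀ j, y j = (∑ j', y j') * w j := by
  classical
  set t : Finset J := univ.filter fun j => 0 < w j with ht
  have hmem : ∀ j ∈ t, 0 < w j := fun j hj => (Finset.mem_filter.1 hj).2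
  have hnot : ∀ j, j ∉ t → w j = 0 := fun j hj =>
    le_antisymm (not_lt.1 fun h => hj (Finset.mem_filter.2 ⟨Finset.mem_univ _, h⟩)) (hw0 j)
  -- the two inequalities of `sum_mul_log_sub_log_le'` are both equalities
  have h1 := sum_mul_log_sub_log_le w y hw0 hw1 hy
  have hw1' : ∑ j ∈ t, w j = 1 := by
    rw [← hw1, ← Finset.sum_filter_add_sum_filter_not univ (fun j => 0 < w j)]
    rw [Finset.sum_eq_zero (s := univ.filter fun j => ¬0 < w j), add_zero]
    intro j hj
    exact le_antisymm (not_lt.1 (Finset.mem_filter.1 hj).2) (hw0 j)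
  obtain ⟨j₀, hj₀⟩ : ∃ j, 0 < w j := by
    by_contra h
    have h' : ∀ j, w j ≤ 0 := fun j => not_lt.1 fun hj => h ⟨j, hj⟩
    have : ∑ j, w j = 0 := Finset.sum_eq_zero fun j _ => le_antisymm (h' j) (hw0 j)
    rw [hw1] at this; exact one_ne_zero this
  have hSt : 0 < ∑ j ∈ t, y j :=
    Finset.sum_pos' (fun i _ => hy0 i) ⟨j₀, Finset.mem_filter.2 ⟨Finset.mem_univ _, hj₀⟩, hy j₀ hj₀⟩
  have hS : 0 < ∑ j, y j := lt_of_lt_of_le hSt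
    (Finset.sum_le_sum_of_subset_of_nonneg (Finset.filter_subset _ _) fun i _ _ => hy0 i)
  have h2 : Real.log (∑ j ∈ t, y j) ≤ Real.log (∑ j, y j) :=
    Real.log_le_log hSt (Finset.sum_le_sum_of_subset_of_nonneg (Finset.filter_subset _ _) fun i _ _ => hy0 i)
  have he1 : ∑ j, w j * (Real.log (y j) - Real.log (w j)) = Real.log (∑ j ∈ t, y j) :=
    le_antisymm h1 (by rw [heq]; exact h2)
  have he2 : ∑ j ∈ t, y j = ∑ j, y j := by
    have : Real.log (∑ j ∈ t, y j) = Real.log (∑ j, y j) := le_antisymm h2 (by rw [← he1, heq])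
    exact Real.log_injOn_pos (Set.mem_Ioi.2 hSt) (Set.mem_Ioi.2 hS) this
  -- off the support, `y = 0`
  have hoff : ∀ j, j ∉ t → y j = 0 := by
    intro j hj
    have hsplit := Finset.sum_filter_add_sum_filter_not univ (fun j => 0 < w j) y
    rw [← ht] at hsplit
    have hrest : ∑ j ∈ univ.filter (fun j => ¬0 < w j), y j = 0 := by linarith
    have hj' : j ∈ univ.filter (fun j => ¬0 < w j) :=
      Finset.mem_filter.2 ⟨Finset.mem_univ _, fun h => hj (Finset.mem_filter.2 ⟨Finset.mem_univ _, h⟩)⟩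
    exact (Finset.sum_eq_zero_iff_of_nonneg (fun i _ => hy0 i)).1 hrest j hj'
  -- on the support, strict Jensen forces `y_j / w_j` constant
  have hJsum : ∑ j ∈ t, w j * (Real.log (y j) - Real.log (w j)) =
      ∑ j, w j * (Real.log (y j) - Real.log (w j)) := by
    rw [← Finset.sum_filter_add_sum_filter_not univ (fun j => 0 < w j)]
    rw [Finset.sum_eq_zero (s := univ.filter fun j => ¬0 < w j), add_zero]
    intro j hj
    have h0 : w j = 0 := le_antisymm (not_lt.1 (Finset.mem_filter.1 hj).2) (hw0 j)
    simp [h0]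
  have hconst : ∀ j ∈ t, ∀ k ∈ t, y j / w j = y k / w k := by
    have hle : Real.log (∑ j ∈ t, w j • (y j / w j)) ≤ ∑ j ∈ t, w j • Real.log (y j / w j) := by
      have hl : ∑ j ∈ t, w j • (y j / w j) = ∑ j ∈ t, y j :=
        Finset.sum_congr rfl fun j hj => by rw [smul_eq_mul, mul_div_cancel₀ _ (hmem j hj).ne']
      have hr : ∑ j ∈ t, w j • Real.log (y j / w j) = ∑ j ∈ t, w j * (Real.log (y j) - Real.log (w j)) :=
        Finset.sum_congr rfl fun j hj => by
          rw [smul_eq_mul, Real.log_div (hy j (hmem j hj)).ne' (hmem j hj).ne']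
      rw [hl, hr, hJsum, he1]
    intro j hj k hk
    exact strictConcaveOn_log_Ioi.eq_of_map_sum_eq (t := t) (w := w) (p := fun j => y j / w j)
      (fun j hj => hmem j hj) hw1' (fun j hj => Set.mem_Ioi.2 (div_pos (hy j (hmem j hj)) (hmem j hj)))
      hle hj hk
  -- the constant is `Σ y`
  have hval : ∀ j ∈ t, y j / w j = ∑ j', y j' := by
    intro j hj
    have : ∑ k ∈ t, y k = ∑ k ∈ t, (y j / w j) * w k := by
      refine Finset.sum_congr rfl fun k hk => ?_
      rw [hconst j hj k hk, div_mul_cancel₀ _ (hmem k hk).ne']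
    rw [← Finset.mul_sum, hw1', mul_one] at this
    rw [← he2, this]
  intro j
  by_cases hj : j ∈ t
  · rw [← hval j hj, div_mul_cancel₀ _ (hmem j hj).ne']
  · rw [hoff j hj, hnot j hj, mul_zero]

end GibbsEq

section RankOne

/-- **Rank one from proportional `B_λ`-images**: if the `B_λ`-images of the rows of a `2 × 2` matrix
`R` are all multiples of one vector then `R` has rank one, `R_{jl} R_{j'l'} = R_{jl'} R_{j'l}`
(`B_λ` is invertible: `det B_λ = -λ^{2/d} ≠ 0`). [folklore] -/
theorem cross_eq_of_slyBlam_rows_proportional {d : ℕ} {lam : ℝ} (hlam : 0 < lam) (R : Fin 2 → Fin 2 → ℝ)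
    (φ : Fin 2 → ℝ) (ν : Fin 2 → ℝ) (h : ∀ j k, ∑ l, slyBlam d lam k l * R j l = ν j * φ k) :
    ∀ j j' l l', R j l * R j' l' = R j l' * R j' l := by
  obtain ⟨h00, h01, h10, h11⟩ := slyBlam_apply d lam
  set t : ℝ := lam ^ (1 / (d : ℝ)) with ht
  have ht0 : 0 < t := Real.rpow_pos_of_pos hlam _
  -- solve for the rows: `R j 0 = ν_j φ_1 / t`, `R j 1 = ν_j (φ_0 - φ_1/t) / t`
  have hrow0 : ∀ j, R j 0 = ν j * (φ 1 / t) := by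
    intro j
    have e1 := h j 1
    simp only [Fin.sum_univ_two, h10, h11, zero_mul, add_zero] at e1
    field_simp
    linarith [e1, mul_comm t (R j 0)]
  have hrow1 : ∀ j, R j 1 = ν j * ((φ 0 - φ 1 / t) / t) := by
    intro j
    have e0 := h j 0
    simp only [Fin.sum_univ_two, h00, h01, one_mul] at e0
    rw [hrow0 j] at e0
    field_simp
    field_simp at e0
    linarith [e0, mul_comm t (R j 1)]
  have hR : ∀ j l, R j l = ν j * (![φ 1 / t, (φ 0 - φ 1 / t) / t] l) := by
    intro j l
    fin_cases l
    · exact hrow0 j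
    · exact hrow1 j
  intro j j' l l'
  rw [hR j l, hR j' l', hR j l', hR j' l]
  ring

/-- **A rank-one probability table with equal prescribed margins is the product of the margins.**
[folklore] -/
theorem eq_mul_of_cross_eq {κ : Type*} [Fintype κ] (δ : κ → κ → ℝ) (β : κ → ℝ)
    (hcross : ∀ j j' l l', δ j l * δ j' l' = δ j l' * δ j' l)
    (hrow : ∀ j, ∑ l, δ j l = β j) (hcol : ∀ l, ∑ j, δ j l = β l) (hβ : ∑ j, β j = 1) :
    ∀ j l, δ j l = β j * β l := by
  intro j l
  have htot : ∑ j', ∑ l', δ j' l' = 1 := by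
    rw [Finset.sum_congr rfl fun j' _ => hrow j', hβ]
  calc δ j l = δ j l * ∑ j', ∑ l', δ j' l' := by rw [htot, mul_one]
    _ = ∑ j', ∑ l', δ j l' * δ j' l := by
        rw [Finset.mul_sum]
        refine Finset.sum_congr rfl fun j' _ => ?_
        rw [Finset.mul_sum]
        refine Finset.sum_congr rfl fun l' _ => hcross j j' l l'
    _ = (∑ l', δ j l') * ∑ j', δ j' l := by
        rw [Finset.sum_comm, Finset.sum_mul]
        refine Finset.sum_congr rfl fun l' _ => ?_
        rw [Finset.mul_sum]
    _ = β j * β l := by rw [hrow, hcol]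

end RankOne

section Unique

variable {d : ℕ} {lam pp pm : ℝ}

/-- **The single-layer hard-core table with densities `(α, β)`** (spins `Fin 2`, `1` = occupied):
`x₁(1,1) = 0`, `x₁(1,0) = α`, `x₁(0,1) = β`, `x₁(0,0) = 1 - α - β` — the unique edge-type table of
a perfect matching compatible with a configuration of densities `(α, β)`. [cite: GalanisStefankovicVigoda2015, §2 eq. (4) (the table `X`; for the hard-core model it is determined by `(α, β)`)] -/
noncomputable def slyTable1 (α β : ℝ) (i j : Fin 2) : ℝ :=
  if i = 1 ∧ j = 1 then 0 else if i = 1 then α else if j = 1 then β else 1 - α - β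

/-- Entries of `slyTable1`. [folklore] -/
theorem slyTable1_apply (α β : ℝ) :
    slyTable1 α β 0 0 = 1 - α - β ∧ slyTable1 α β 0 1 = β ∧ slyTable1 α β 1 0 = α ∧
      slyTable1 α β 1 1 = 0 := by
  refine ⟨?_, ?_, ?_, ?_⟩ <;> simp [slyTable1]

/-- A `2 × 2` nonnegative table is determined by its row and column sums and its `(1,1)` entry.
[folklore] -/
theorem eq_slyTable1_of_margins (x₁ : Fin 2 → Fin 2 → ℝ) {α β : ℝ} (h11 : x₁ 1 1 = 0)
    (hr1 : x₁ 1 0 + x₁ 1 1 = α) (hc1 : x₁ 0 1 + x₁ 1 1 = β) (hr0 : x₁ 0 0 + x₁ 0 1 = 1 - α) :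
    ∀ i j, x₁ i j = slyTable1 α β i j := by
  obtain ⟨e00, e01, e10, e11⟩ := slyTable1_apply α β
  intro i j
  fin_cases i <;> fin_cases j
  · show x₁ 0 0 = slyTable1 α β 0 0
    rw [e00]; linarith
  · show x₁ 0 1 = slyTable1 α β 0 1
    rw [e01]; linarith
  · show x₁ 1 0 = slyTable1 α β 1 0
    rw [e10]; linarith
  · show x₁ 1 1 = slyTable1 α β 1 1
    rw [e11, h11]

/-- Square roots of products: if `r_i r_k = a_i a_k` for all `i, k` with `r, a ≥ 0` then `r = a`.
[folklore] -/
theorem eq_of_mul_self_eq {κ : Type*} (r a : κ → ℝ) (hr : ∀ i, 0 ≤ r i) (ha : ∀ i, 0 ≤ a i)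
    (h : ∀ i k, r i * r k = a i * a k) : ∀ i, r i = a i := by
  intro i
  have h2 : r i * r i = a i * a i := h i i
  have := mul_self_eq_mul_self_iff.1 h2
  rcases this with h' | h'
  · exact h'
  · have : r i = 0 := by nlinarith [hr i, ha i]
    rw [this] at h2 ⊢
    nlinarith [ha i]

/-- **Uniqueness of the maximiser of the hard-core second-moment exponent** (GŠV15 Lemma 3.2 for
the hard-core model; the uniqueness half of Sly's Condition 1.2 at the dominant phase): for `d ≥ 3`,
`λ > λ_c(𝕋_d)` and the asymmetric critical point `(p⁺, p⁻)`, a probability table `x` of the paired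
hard-core model whose two layers both have the marginal densities `(p⁺, p⁻)` and whose exponent
`d Σ x(log(B_λ ⊗ B_λ) - log x) + (d-1)(Σ γ log γ + Σ δ log δ)` ATTAINS the bound `2 Φ₁(p⁺, p⁻)` of
`pair_table_entropy_le_two_slyPhi1` is the product `x₁ ⊗ x₁` of two copies of the single-layer
table `slyTable1 p⁺ p⁻` (uncorrelated pairs: overlaps `γ = α ⊗ α`, `δ = β ⊗ β`). Proof: every step
of the chain Jensen ≤ Hölder ≤ Bennett ≤ norm value is an equality; Bennett's equality makes the
`2 × 2` matrix `δ^e` rank one (`bennett_eq_rows_proportional`, `cross_eq_of_slyBlam_rows_proportional`),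
hence `δ = β ⊗ β` by the marginal constraints; Hölder's equality then gives `γ = α ⊗ α`, and Jensen's
equality `x ∝ (B⊗B) γ^e δ^e` factorises. [cite: GalanisStefankovicVigoda2015, Lemma 3.2; Sly2010, Condition 1.2 ("attains its unique maximum")] -/
theorem pair_table_eq_product_of_entropy_eq (hd : 3 ≤ d) (hlam : hardCoreThreshold d < lam)
    (hpm : 0 < pm) (hlt : pm < pp) (hsum : pp + pm < 1)
    (hEα : lam * (1 - pp - pm) ^ d = pp * (1 - pp) ^ (d - 1))
    (hEβ : lam * (1 - pp - pm) ^ d = pm * (1 - pm) ^ (d - 1))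
    (x : Fin 2 × Fin 2 → Fin 2 × Fin 2 → ℝ) (hx : ∀ a b, 0 ≤ x a b)
    (hx1 : ∑ a, ∑ b, x a b = 1)
    (hsupp : ∀ a b, 0 < x a b → ¬(a.1 = 1 ∧ b.1 = 1) ∧ ¬(a.2 = 1 ∧ b.2 = 1))
    (hγ1 : ∀ i, ∑ k, ∑ b, x (i, k) b = ![1 - pp, pp] i)
    (hγ2 : ∀ k, ∑ i, ∑ b, x (i, k) b = ![1 - pp, pp] k)
    (hδ1 : ∀ j, ∑ l, ∑ a, x a (j, l) = ![1 - pm, pm] j)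
    (hδ2 : ∀ l, ∑ j, ∑ a, x a (j, l) = ![1 - pm, pm] l)
    (heq : (d : ℝ) * ∑ a, ∑ b, x a b *
        (Real.log (slyBlam d lam a.1 b.1 * slyBlam d lam a.2 b.2) - Real.log (x a b)) +
      ((d : ℝ) - 1) * (∑ a, (∑ b, x a b) * Real.log (∑ b, x a b) +
        ∑ b, (∑ a, x a b) * Real.log (∑ a, x a b)) = 2 * slyPhi1 d lam pp pm) :
    ∀ a b, x a b = slyTable1 pp pm a.1 b.1 * slyTable1 pp pm a.2 b.2 := by
  classical
  -- ### setup (as in `pair_table_entropy_le_two_slyPhi1`)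
  have hd1 : 1 ≤ d := by omega
  have hd2 : 2 ≤ d := by omega
  have hdR : (0 : ℝ) < d := by exact_mod_cast (by omega : 0 < d)
  have hdR1 : (1 : ℝ) < d := by exact_mod_cast (by omega : 1 < d)
  have hdR3 : (3 : ℝ) ≤ d := by exact_mod_cast hd
  have hdne : (d : ℝ) - 1 ≠ 0 := by linarith
  have hlam0 : 0 < lam := (hardCoreThreshold_pos hd).trans hlam
  set M : ℝ := slyPhi1 d lam pp pm with hM
  set K : ℝ := Real.exp (M / d) with hK
  have hK0 : 0 < K := Real.exp_pos _
  set e : ℝ := ((d : ℝ) - 1) / d with he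
  have he0 : 0 < e := div_pos (by linarith) hdR
  set p : ℝ := (d : ℝ) / ((d : ℝ) - 1) with hp
  have hp0 : 0 < p := div_pos hdR (by linarith)
  have hep : e * p = 1 := by rw [he, hp]; field_simp
  have hpe : 1 / p = e := by rw [hp, he, one_div, inv_div]
  have hpd : p.HolderConjugate d :=
    { inv_add_inv_eq_inv := by rw [inv_one, hp, inv_div]; field_simp; ring
      left_pos := hp0
      right_pos := hdR }
  have hplt : p < d := by
    rw [hp, div_lt_iff₀ (by linarith)]; nlinarith
  set B := slyBlam d lam with hB
  have hB0 : ∀ i j, 0 ≤ B i j := slyBlam_nonneg d hlam0.le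
  have hBpos : ∀ i j : Fin 2, ¬(i = 1 ∧ j = 1) → 0 < B i j := by
    intro i j hij; rw [hB]; unfold slyBlam; rw [if_neg hij]; exact Real.rpow_pos_of_pos hlam0 _
  set M₂ : Fin 2 × Fin 2 → Fin 2 × Fin 2 → ℝ := fun a b => B a.1 b.1 * B a.2 b.2 with hM₂
  have hM₂0 : ∀ a b, 0 ≤ M₂ a b := fun a b => mul_nonneg (hB0 _ _) (hB0 _ _)
  have hsupp' : ∀ a b, 0 < x a b → 0 < M₂ a b := by
    intro a b hpos
    obtain ⟨h1, h2⟩ := hsupp a b hpos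
    exact mul_pos (hBpos _ _ h1) (hBpos _ _ h2)
  -- the norm bounds
  have hKB : ∀ c : Fin 2 → ℝ, (∀ j, 0 ≤ c j) →
      (∑ i, (∑ j, B i j * c j) ^ (d : ℝ)) ^ (1 / (d : ℝ)) ≤ K * (∑ j, c j ^ p) ^ (1 / p) := by
    intro c hc
    have h := slyBlam_normBound hd hlam hpm hlt hsum hEα hEβ c hc
    rw [← he, ← hp, ← hM, ← hK] at h
    rw [hpe]; exact h
  -- ### marginals
  set γ : Fin 2 × Fin 2 → ℝ := fun a => ∑ b, x a b with hγ
  set δ : Fin 2 × Fin 2 → ℝ := fun b => ∑ a, x a b with hδ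
  have hγ0 : ∀ a, 0 ≤ γ a := fun a => Finset.sum_nonneg fun b _ => hx a b
  have hδ0 : ∀ b, 0 ≤ δ b := fun b => Finset.sum_nonneg fun a _ => hx a b
  have hγsum : ∑ a, γ a = 1 := hx1
  have hδsum : ∑ b, δ b = 1 := by rw [hδ, Finset.sum_comm]; exact hx1
  have hxγ : ∀ a b, x a b ≤ γ a := fun a b =>
    Finset.single_le_sum (f := fun b => x a b) (fun b _ => hx a b) (Finset.mem_univ b)
  have hxδ : ∀ a b, x a b ≤ δ b := fun a b =>
    Finset.single_le_sum (f := fun a => x a b) (fun a _ => hx a b) (Finset.mem_univ a)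
  -- ### the quantities of the chain
  set y : Fin 2 × Fin 2 → Fin 2 × Fin 2 → ℝ := fun a b => M₂ a b * γ a ^ e * δ b ^ e with hy
  have hy0 : ∀ a b, 0 ≤ y a b := fun a b =>
    mul_nonneg (mul_nonneg (hM₂0 a b) (Real.rpow_nonneg (hγ0 a) _)) (Real.rpow_nonneg (hδ0 b) _)
  set v : Fin 2 × Fin 2 → ℝ := fun a => ∑ b, M₂ a b * δ b ^ e with hv
  have hv0 : ∀ a, 0 ≤ v a := fun a => Finset.sum_nonneg fun b _ => mul_nonneg (hM₂0 a b) (Real.rpow_nonneg (hδ0 b) _)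
  set S : ℝ := ∑ a, ∑ b, y a b with hS
  have hSv : S = ∑ a, γ a ^ e * v a := by
    rw [hS]; refine Finset.sum_congr rfl fun a _ => ?_
    rw [hv, Finset.mul_sum]; refine Finset.sum_congr rfl fun b _ => ?_
    rw [hy]; ring
  set V : ℝ := ∑ a, v a ^ (d : ℝ) with hV
  have hV0 : 0 ≤ V := Finset.sum_nonneg fun a _ => Real.rpow_nonneg (hv0 a) _
  -- the exponent `J`, as a Gibbs sum
  set J : ℝ := ∑ a, ∑ b, x a b * (Real.log (M₂ a b) - Real.log (x a b)) +
    e * (∑ a, γ a * Real.log (γ a) + ∑ b, δ b * Real.log (δ b)) with hJ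
  have hJgibbs : J = ∑ ab : (Fin 2 × Fin 2) × (Fin 2 × Fin 2),
      x ab.1 ab.2 * (Real.log (y ab.1 ab.2) - Real.log (x ab.1 ab.2)) := by
    have hexp : ∀ a b, x a b * (Real.log (y a b) - Real.log (x a b)) =
        x a b * (Real.log (M₂ a b) - Real.log (x a b)) + e * (x a b * Real.log (γ a)) +
          e * (x a b * Real.log (δ b)) := by
      intro a b
      rcases (hx a b).eq_or_lt with h0 | hpos
      · rw [← h0]; ring
      · have hγa : 0 < γ a := lt_of_lt_of_le hpos (hxγ a b)
        have hδb : 0 < δ b := lt_of_lt_of_le hpos (hxδ a b)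
        have hMab : 0 < M₂ a b := hsupp' a b hpos
        rw [hy]
        simp only
        rw [Real.log_mul (mul_pos hMab (Real.rpow_pos_of_pos hγa _)).ne' (Real.rpow_pos_of_pos hδb _).ne',
          Real.log_mul hMab.ne' (Real.rpow_pos_of_pos hγa _).ne', Real.log_rpow hγa, Real.log_rpow hδb]
        ring
    rw [Fintype.sum_prod_type]
    simp only
    rw [Finset.sum_congr rfl fun a _ => Finset.sum_congr rfl fun b _ => hexp a b]
    simp only [Finset.sum_add_distrib, ← Finset.mul_sum]
    have h1 : ∑ a, ∑ b, x a b * Real.log (γ a) = ∑ a, γ a * Real.log (γ a) := by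
      refine Finset.sum_congr rfl fun a _ => ?_; rw [← Finset.sum_mul]
    have h2 : ∑ a, ∑ b, x a b * Real.log (δ b) = ∑ b, δ b * Real.log (δ b) := by
      rw [Finset.sum_comm]; refine Finset.sum_congr rfl fun b _ => ?_; rw [← Finset.sum_mul]
    rw [h1, h2, hJ]; ring
  -- ### the three inequalities
  have hI1 : J ≤ Real.log S := by
    have h := table_entropy_le_log M₂ x hM₂0 hx hx1 hsupp' e
    rw [hJ, hS]; exact h
  have hI2 : S ≤ V ^ (1 / (d : ℝ)) := by
    have h := sum_rpow_mul_le_norm M₂ hM₂0 γ δ hγ0 hδ0 hd2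
    rw [← he, hγsum, Real.one_rpow, one_mul] at h
    have hS' : S = ∑ a, ∑ b, M₂ a b * γ a ^ e * δ b ^ e := by rw [hS]
    rw [hS']; exact h
  have hKpair := bennett_tensor_sq_le_real B hB0 hp0 hplt.le hK0.le hKB (fun j l => δ (j, l) ^ e)
    (fun j l => Real.rpow_nonneg (hδ0 _) _)
  have hRsum : ∑ jl : Fin 2 × Fin 2, (δ (jl.1, jl.2) ^ e) ^ p = 1 := by
    have : ∀ jl : Fin 2 × Fin 2, (δ (jl.1, jl.2) ^ e) ^ p = δ jl := by
      intro jl; rw [← Real.rpow_mul (hδ0 _), hep, Real.rpow_one]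
    simp only [this, hδsum]
  have hVsum : ∑ ik : Fin 2 × Fin 2, (∑ jl : Fin 2 × Fin 2, B ik.1 jl.1 * B ik.2 jl.2 * δ (jl.1, jl.2) ^ e) ^ (d : ℝ) = V := by
    rw [hV]
  have hI3 : V ^ (1 / (d : ℝ)) ≤ K ^ 2 := by
    have h := hKpair
    rw [hRsum, Real.one_rpow, mul_one, hVsum] at h
    exact h
  -- ### the value
  have hlogK : Real.log (K ^ 2) = 2 * (M / d) := by
    rw [Real.log_pow, hK, Real.log_exp]; push_cast; ring
  have hJval : J = 2 * (M / d) := by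
    have hd0 : (d : ℝ) ≠ 0 := hdR.ne'
    have : (d : ℝ) * J = 2 * M := by
      rw [← heq, hJ, hM₂, hγ, hδ, he]
      field_simp
    field_simp
    linarith [this]
  -- positivity of `S`
  have hSpos : 0 < S := by
    obtain ⟨a, b, hab⟩ : ∃ a b, 0 < x a b := by
      by_contra h
      have h' : ∀ a b, x a b = 0 := fun a b => le_antisymm (not_lt.1 fun hab => h ⟨a, b, hab⟩) (hx a b)
      have : ∑ a, γ a = 0 := Finset.sum_eq_zero fun a _ => by
        rw [hγ]; exact Finset.sum_eq_zero fun b _ => h' a b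
      rw [hγsum] at this; exact one_ne_zero this
    have hγa : 0 < γ a := lt_of_lt_of_le hab (hxγ a b)
    have hδb : 0 < δ b := lt_of_lt_of_le hab (hxδ a b)
    have hcell : 0 < y a b := mul_pos (mul_pos (hsupp' a b hab) (Real.rpow_pos_of_pos hγa _))
      (Real.rpow_pos_of_pos hδb _)
    calc (0 : ℝ) < y a b := hcell
      _ ≤ ∑ b', y a b' := Finset.single_le_sum (f := fun b' => y a b') (fun b' _ => hy0 a b') (Finset.mem_univ b)
      _ ≤ S := Finset.single_le_sum (f := fun a' => ∑ b', y a' b') (fun a' _ => Finset.sum_nonneg fun b' _ => hy0 a' b')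
          (Finset.mem_univ a)
  have hVdpos : 0 < V ^ (1 / (d : ℝ)) := lt_of_lt_of_le hSpos hI2
  -- ### all equalities
  have hE1 : J = Real.log S := le_antisymm hI1 (by
    rw [hJval, ← hlogK]
    exact (Real.log_le_log hSpos (hI2.trans hI3)))
  have hE2 : S = V ^ (1 / (d : ℝ)) := by
    refine le_antisymm hI2 ?_
    have h : Real.log (V ^ (1 / (d : ℝ))) ≤ Real.log S := by
      rw [← hE1, hJval, ← hlogK]; exact Real.log_le_log hVdpos hI3
    exact (Real.log_le_log_iff hVdpos hSpos).1 h
  have hE3 : V ^ (1 / (d : ℝ)) = K ^ 2 := by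
    refine le_antisymm hI3 ?_
    have h : Real.log (K ^ 2) ≤ Real.log (V ^ (1 / (d : ℝ))) := by
      rw [← hE2, ← hE1, hJval, hlogK]
    exact (Real.log_le_log_iff (pow_pos hK0 2) hVdpos).1 h
  -- ### (E1) Jensen/Gibbs equality: `y = S · x`
  have hGibbs : ∀ a b, y a b = S * x a b := by
    have h := eq_smul_of_gibbs_eq (J := (Fin 2 × Fin 2) × (Fin 2 × Fin 2))
      (fun ab => x ab.1 ab.2) (fun ab => y ab.1 ab.2) (fun ab => hx _ _)
      (by rw [Fintype.sum_prod_type]; exact hx1) (fun ab => hy0 _ _)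
      (by
        rintro ⟨a, b⟩ hab
        have hγa : 0 < γ a := lt_of_lt_of_le hab (hxγ a b)
        have hδb : 0 < δ b := lt_of_lt_of_le hab (hxδ a b)
        exact mul_pos (mul_pos (hsupp' a b hab) (Real.rpow_pos_of_pos hγa _)) (Real.rpow_pos_of_pos hδb _))
      (by
        rw [← hJgibbs, hE1, hS]
        congr 1
        exact (Fintype.sum_prod_type (fun j : (Fin 2 × Fin 2) × (Fin 2 × Fin 2) => y j.1 j.2)).symm)
    intro a b
    have := h (a, b)
    simp only at this
    rw [Fintype.sum_prod_type] at this
    exact this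
  -- ### (E3) Bennett equality: `δ^e` has rank one, hence `δ = β ⊗ β`
  set βv : Fin 2 → ℝ := ![1 - pm, pm] with hβv
  have hβv0 : ∀ j, 0 < βv j := by
    intro j; fin_cases j <;> simp [hβv] <;> linarith
  have hβvsum : ∑ j, βv j = 1 := by simp [hβv, Fin.sum_univ_two]
  have hKpow : (K ^ 2) ^ (d : ℝ) = K ^ (d : ℝ) * K ^ (d : ℝ) := by
    rw [sq, Real.mul_rpow hK0.le hK0.le]
  have hVval : V = K ^ (d : ℝ) * (K ^ p * ∑ jl : Fin 2 × Fin 2, (δ (jl.1, jl.2) ^ e) ^ p) ^ ((d : ℝ) / p) := by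
    rw [hRsum, mul_one, ← Real.rpow_mul hK0.le, mul_div_cancel₀ _ hp0.ne', ← hKpow, ← hE3, ← Real.rpow_mul hV0,
      one_div_mul_cancel hdR.ne', Real.rpow_one]
  obtain ⟨φ, hφ0, hrows⟩ := Literature.Analysis.Matrix.bennett_eq_rows_proportional B B hB0 hB0 hp0 hplt
    hK0 hK0.le hKB hKB (fun j l => δ (j, l) ^ e) (fun j l => Real.rpow_nonneg (hδ0 _) _)
    (by rw [hVsum, hVval])
  choose ν hν0 hν using hrows
  have hcrossR := cross_eq_of_slyBlam_rows_proportional hlam0 (fun j l => δ (j, l) ^ e) φ ν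
    (fun j k => by rw [← hB]; exact hν j k)
  have hcrossδ : ∀ j j' l l', δ (j, l) * δ (j', l') = δ (j, l') * δ (j', l) := by
    intro j j' l l'
    have h := hcrossR j j' l l'
    rw [← Real.mul_rpow (hδ0 _) (hδ0 _), ← Real.mul_rpow (hδ0 _) (hδ0 _)] at h
    exact (Real.rpow_left_inj (mul_nonneg (hδ0 _) (hδ0 _)) (mul_nonneg (hδ0 _) (hδ0 _)) he0.ne').1 h
  have hδprod : ∀ j l, δ (j, l) = βv j * βv l := by
    refine eq_mul_of_cross_eq (fun j l => δ (j, l)) βv hcrossδ (fun j => ?_) (fun l => ?_) hβvsum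
    · simp only [hδ]; exact hδ1 j
    · simp only [hδ]; exact hδ2 l
  -- ### (E2) Hölder equality: `γ ∝ v^d`, and `v = w ⊗ w`, hence `γ = α ⊗ α`
  set w : Fin 2 → ℝ := fun i => ∑ j, B i j * βv j ^ e with hw
  have hwpos : ∀ i, 0 < w i := by
    obtain ⟨h00, h01, h10, h11⟩ := slyBlam_apply d lam
    have ht0 : 0 < lam ^ (1 / (d : ℝ)) := Real.rpow_pos_of_pos hlam0 _
    intro i
    fin_cases i
    · show 0 < ∑ j, B 0 j * βv j ^ e
      rw [Fin.sum_univ_two, hB, h00, h01]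
      have := Real.rpow_pos_of_pos (hβv0 0) e
      have := Real.rpow_pos_of_pos (hβv0 1) e
      positivity
    · show 0 < ∑ j, B 1 j * βv j ^ e
      rw [Fin.sum_univ_two, hB, h10, h11, zero_mul, add_zero]
      exact mul_pos ht0 (Real.rpow_pos_of_pos (hβv0 0) e)
  have hvw : ∀ i k, v (i, k) = w i * w k := by
    intro i k
    rw [hv]
    simp only
    rw [Fintype.sum_prod_type, hw, Finset.sum_mul_sum]
    refine Finset.sum_congr rfl fun j _ => Finset.sum_congr rfl fun l _ => ?_
    rw [hM₂]
    simp only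
    rw [hδprod, Real.mul_rpow (hβv0 j).le (hβv0 l).le]
    ring
  have hvpos : ∀ a, 0 < v a := by rintro ⟨i, k⟩; rw [hvw]; exact mul_pos (hwpos i) (hwpos k)
  obtain ⟨c, c', hc, hc', hcc', hprop⟩ := Literature.Analysis.Matrix.holder_eq_proportional univ
    (fun a => γ a ^ e) v hpd (fun a _ => Real.rpow_nonneg (hγ0 a) _) (fun a _ => (hvpos a).le)
    (by
      have h1 : ∀ a, (γ a ^ e) ^ p = γ a := fun a => by rw [← Real.rpow_mul (hγ0 a), hep, Real.rpow_one]
      simp only [h1, hγsum, Real.one_rpow, one_mul]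
      rw [← hSv, hE2])
  have h1 : ∀ a, (γ a ^ e) ^ p = γ a := fun a => by rw [← Real.rpow_mul (hγ0 a), hep, Real.rpow_one]
  simp only [h1] at hprop
  have hcpos : 0 < c := by
    rcases hc.eq_or_lt with h0 | h0
    · exfalso
      have hprop0 := hprop (0, 0) (Finset.mem_univ _)
      rw [← h0, zero_mul] at hprop0
      have hc'0 : c' = 0 := by
        rcases mul_eq_zero.1 hprop0.symm with h | h
        · exact h
        · exact absurd h (Real.rpow_pos_of_pos (hvpos _) _).ne'
      rcases hcc' with h | h
      · exact h h0.symm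
      · exact h hc'0
    · exact h0
  have hγform : ∀ i k, γ (i, k) = c' / c * (w i ^ (d : ℝ) * w k ^ (d : ℝ)) := by
    intro i k
    have h := hprop (i, k) (Finset.mem_univ _)
    rw [hvw, Real.mul_rpow (hwpos i).le (hwpos k).le] at h
    field_simp
    linarith [h]
  set αv : Fin 2 → ℝ := ![1 - pp, pp] with hαv
  have hαv0 : ∀ i, 0 < αv i := by
    intro i; fin_cases i <;> simp [hαv] <;> linarith
  have hαvsum : ∑ i, αv i = 1 := by simp [hαv, Fin.sum_univ_two]
  have hcrossγ : ∀ i i' k k', γ (i, k) * γ (i', k') = γ (i, k') * γ (i', k) := by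
    intro i i' k k'
    rw [hγform, hγform, hγform, hγform]
    ring
  have hγprod : ∀ i k, γ (i, k) = αv i * αv k := by
    refine eq_mul_of_cross_eq (fun i k => γ (i, k)) αv hcrossγ (fun i => ?_) (fun k => ?_) hαvsum
    · simp only [hγ]; exact hγ1 i
    · simp only [hγ]; exact hγ2 k
  -- ### the factorisation `x = x₁ ⊗ x₁`
  set y₁ : Fin 2 → Fin 2 → ℝ := fun i j => B i j * αv i ^ e * βv j ^ e with hy₁
  have hy₁0 : ∀ i j, 0 ≤ y₁ i j := fun i j =>
    mul_nonneg (mul_nonneg (hB0 i j) (Real.rpow_nonneg (hαv0 i).le _)) (Real.rpow_nonneg (hβv0 j).le _)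
  have hyfac : ∀ a b, y a b = y₁ a.1 b.1 * y₁ a.2 b.2 := by
    rintro ⟨i, k⟩ ⟨j, l⟩
    rw [hy, hy₁]
    simp only
    rw [hγprod, hδprod, hM₂]
    simp only
    rw [Real.mul_rpow (hαv0 i).le (hαv0 k).le, Real.mul_rpow (hβv0 j).le (hβv0 l).le]
    ring
  set Y₁ : ℝ := ∑ i, ∑ j, y₁ i j with hY₁
  have hY₁0 : 0 ≤ Y₁ := Finset.sum_nonneg fun i _ => Finset.sum_nonneg fun j _ => hy₁0 i j
  have hSY : S = Y₁ ^ 2 := by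
    calc S = ∑ i, ∑ k, ∑ j, ∑ l, y₁ i j * y₁ k l := by
          rw [hS, Fintype.sum_prod_type]
          refine Finset.sum_congr rfl fun i _ => Finset.sum_congr rfl fun k _ => ?_
          rw [Fintype.sum_prod_type]
          refine Finset.sum_congr rfl fun j _ => Finset.sum_congr rfl fun l _ => ?_
          exact hyfac (i, k) (j, l)
      _ = ∑ i, ∑ j, ∑ k, ∑ l, y₁ i j * y₁ k l := by
          refine Finset.sum_congr rfl fun i _ => ?_
          rw [Finset.sum_comm]
      _ = Y₁ ^ 2 := by
          rw [sq]
          nth_rewrite 1 [hY₁]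
          rw [Finset.sum_mul]
          refine Finset.sum_congr rfl fun i _ => ?_
          rw [Finset.sum_mul]
          refine Finset.sum_congr rfl fun j _ => ?_
          rw [hY₁, Finset.mul_sum]
          refine Finset.sum_congr rfl fun k _ => ?_
          rw [Finset.mul_sum]
  have hY₁pos : 0 < Y₁ := by
    rcases hY₁0.eq_or_lt with h0 | h0
    · exfalso; rw [hSY, ← h0] at hSpos; simp at hSpos
    · exact h0
  set x₁ : Fin 2 → Fin 2 → ℝ := fun i j => y₁ i j / Y₁ with hx₁
  have hx₁0 : ∀ i j, 0 ≤ x₁ i j := fun i j => div_nonneg (hy₁0 i j) hY₁pos.le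
  have hxfac : ∀ a b, x a b = x₁ a.1 b.1 * x₁ a.2 b.2 := by
    intro a b
    have h := hGibbs a b
    rw [hyfac, hSY] at h
    rw [hx₁]
    simp only
    field_simp
    linarith [h]
  -- ### identify `x₁` by its margins
  have hr : ∀ i, x₁ i 0 + x₁ i 1 = αv i := by
    have hmul : ∀ i k, (x₁ i 0 + x₁ i 1) * (x₁ k 0 + x₁ k 1) = αv i * αv k := by
      intro i k
      rw [← hγprod i k, hγ]
      simp only
      rw [Fintype.sum_prod_type]
      simp only [Fin.sum_univ_two, hxfac]
      ring
    exact eq_of_mul_self_eq _ _ (fun i => add_nonneg (hx₁0 i 0) (hx₁0 i 1)) (fun i => (hαv0 i).le) hmul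
  have hc : ∀ j, x₁ 0 j + x₁ 1 j = βv j := by
    have hmul : ∀ j l, (x₁ 0 j + x₁ 1 j) * (x₁ 0 l + x₁ 1 l) = βv j * βv l := by
      intro j l
      rw [← hδprod j l, hδ]
      simp only
      rw [Fintype.sum_prod_type]
      simp only [Fin.sum_univ_two, hxfac]
      ring
    exact eq_of_mul_self_eq _ _ (fun j => add_nonneg (hx₁0 0 j) (hx₁0 1 j)) (fun j => (hβv0 j).le) hmul
  have hx11 : x₁ 1 1 = 0 := by
    rw [hx₁]
    simp only
    rw [hy₁]
    simp only
    rw [hB, (slyBlam_apply d lam).2.2.2]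
    simp
  have hx₁eq : ∀ i j, x₁ i j = slyTable1 pp pm i j := by
    refine eq_slyTable1_of_margins x₁ hx11 ?_ ?_ ?_
    · have := hr 1; simp [hαv] at this; linarith
    · have := hc 1; simp [hβv] at this; linarith [hx11]
    · have := hr 0; simp [hαv] at this; linarith
  intro a b
  rw [hxfac, hx₁eq, hx₁eq]

end Unique


end Literature.Computability.Complexity
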